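import Summits.CriticalPhenomena.CardyFormulaZ2.Theorems.CardyFlipRussoQuadrupoleSelectionRuleAnnealedRusso
import Summits.CriticalPhenomena.CardyFormulaZ2.Theorems.CardyFlipRussoQuadrupoleSelectionRuleLegMVT

/-!
# Kernel bound ⟹ constancy of annealed crossing probabilities along a flip leg of independent bits

Helper file for the crux `QuadrupoleSelectionRule` (stmt-CriticalPhenomena-7029, informal) of route
`CardyFlipRusso` (sub-problem `CardyFormulaZ2`), line `Sketch`, generation 2 — the CONCRETE end of
the transfer chain for the route's leg L5 of `SquareFromVoronoiHub` (independent diagonals, every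
face `k ∈ K δ` of the grid at mesh `δ` carrying one of its two diagonals, `P(BD-diagonal) = t`),
and for every other leg whose environment is a product of independent bits.

Vocabulary of the tree only: the environment law `prodBernoulli (fun _ ↦ t)`
(`Literature.Probability.LatticeModels.prodBernoulli`), the graph `Γ δ τ`, the flip
`flipGraph` / `flipResponse` (`Literature.Probability.Percolation.FlipResponse`), the colours
`sitePercolation V p`, the mesh-indexed graph-dependent event `U δ` (e.g. the open crossing of a
conformal rectangle at mesh `δ`).  The annealed crossing probability along the leg is
`P t δ = E_t[P_p(U δ (Γ δ τ))]` and the annealed flip–Russo formula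
(`hasDerivWithinAt_annealed_flipLeg`, landed) says `d/dt P t δ = Σ_{k ∈ K δ} E_t[Δ_k]` with
`Δ_k = flipResponse (Γ δ (τ \ {k})) (A k) (B k) (C k) (D k) (U δ) p`.

* `uniform_close_annealed_flipLeg_of_kernel_bound` — **the consumed form of the kernel crux on a
  bits leg**: if the annealed flip sum is small uniformly in the leg parameter,
  `|Σ_{k ∈ K δ} E_t[Δ_k]| ≤ η δ` for `t ∈ [0, 1]` with `η δ → 0` as `δ → 0⁺`, then the annealed
  crossing probabilities are uniformly close along the whole leg for small mesh — exactly what an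
  `ε/2`-argument against the anchored end of the leg consumes (composition of the landed Russo
  formula with the mean-value step `uniform_close_of_deriv_bound`, stub T6).
* `abs_sum_le_of_expansion` — the bookkeeping of clauses (ii)+(iii) of the crux at the level of
  the annealed summands: if `E_t[Δ_k] = m_k + r_k` with `Σ_k m_k = 0` (isotropic cancellation of
  the spin-2 channel, stub T4 / `quadrupole_cyclic_average_eq_zero`) and `Σ_k |r_k| ≤ η`
  (summable remainder), then `|Σ_k E_t[Δ_k]| ≤ η` — the hypothesis of the first theorem.

So, on a bits leg, a TYPED kernel crux of the form "`sup_{t ∈ [0,1]} |Σ_{k ∈ K δ} E_t[Δ_k]| → 0`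
as `δ → 0`" (or its (ii)+(iii) refinement) closes the leg by these two theorems and the landed
Russo formula; nothing else about derivatives is needed.
-/

noncomputable section

open MeasureTheory Set Filter
open scoped Topology BigOperators

namespace Summit.CriticalPhenomena.CardyFormulaZ2.Theorems

open Literature.Probability.LatticeModels Literature.Probability.Percolation

/-- **(ii)+(iii) bookkeeping.** If every annealed flip summand splits as `e k = m k + r k` with
`Σ m = 0` (the symmetry-cancelled main channel) and `Σ |r| ≤ η` (summable remainder), then the
annealed flip sum is bounded by `η`. [folklore] -/
theorem abs_sum_le_of_expansion {κ : Type*} (K : Finset κ) (e m r : κ → ℝ)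
    (he : ∀ k ∈ K, e k = m k + r k) (hm : ∑ k ∈ K, m k = 0) (η : ℝ)
    (hr : ∑ k ∈ K, |r k| ≤ η) : |∑ k ∈ K, e k| ≤ η := by
  have hsum : ∑ k ∈ K, e k = ∑ k ∈ K, r k := by
    rw [Finset.sum_congr rfl he, Finset.sum_add_distrib, hm, zero_add]
  rw [hsum]
  exact (Finset.abs_sum_le_sum_abs _ _).trans hr

/-- **Kernel bound ⟹ leg constancy (bits leg).** Environment of independent bits with law
`prodBernoulli (fun _ ↦ t)`, graph `Γ δ τ` reading only the faces `K δ`, switching face `k`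
being the diagonal flip at `(A k, B k, C k, D k)`; colours `sitePercolation V p`; mesh-indexed
graph event `U δ`.  If the annealed flip sum `Σ_{k ∈ K δ} E_t[Δ_k]` is bounded by `η δ` uniformly
in `t ∈ [0, 1]` and `η δ → 0` as `δ → 0⁺`, then for every `ε > 0` there is `δ₀ > 0` such that the
annealed probabilities `E_t[P_p(U δ (Γ δ τ))]` at any two leg parameters `t, t' ∈ [0, 1]` differ by
at most `ε` whenever `0 < δ < δ₀`. [folklore] -/
theorem uniform_close_annealed_flipLeg_of_kernel_bound {κ V : Type*} [DecidableEq κ]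
    (K : ℝ → Finset κ) (Γ : ℝ → Set κ → SimpleGraph V)
    (hΓ : ∀ (δ : ℝ) (τ : Set κ), Γ δ τ = Γ δ (τ ∩ ↑(K δ))) (A B C D : κ → V)
    (hflip : ∀ (δ : ℝ) (τ : Set κ) (k : κ), k ∈ K δ →
      Γ δ (insert k τ) = flipGraph (Γ δ (τ \ {k})) (A k) (B k) (C k) (D k))
    (U : ℝ → SimpleGraph V → Set (SiteConfig V)) (p : unitInterval) (η : ℝ → ℝ)
    (hkernel : ∀ δ, 0 < δ → δ < 1 → ∀ t ∈ Icc (0 : ℝ) 1,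
      |∑ k ∈ K δ, ∫ τ, flipResponse (Γ δ (τ \ {k})) (A k) (B k) (C k) (D k) (U δ) p
        ∂(prodBernoulli fun _ : κ => Set.projIcc 0 1 zero_le_one t)| ≤ η δ)
    (hη : Tendsto η (𝓝[>] 0) (𝓝 0)) :
    ∀ ε : ℝ, 0 < ε → ∃ δ₀ : ℝ, 0 < δ₀ ∧ ∀ δ : ℝ, 0 < δ → δ < δ₀ →
      ∀ t ∈ Icc (0 : ℝ) 1, ∀ t' ∈ Icc (0 : ℝ) 1,
        |(∫ τ, (sitePercolation V p).real (U δ (Γ δ τ))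
            ∂(prodBernoulli fun _ : κ => Set.projIcc 0 1 zero_le_one t)) -
          ∫ τ, (sitePercolation V p).real (U δ (Γ δ τ))
            ∂(prodBernoulli fun _ : κ => Set.projIcc 0 1 zero_le_one t')| ≤ ε := by
  -- the annealed probability and its Russo derivative as functions of `(t, δ)`
  set P : ℝ → ℝ → ℝ := fun t δ => ∫ τ, (sitePercolation V p).real (U δ (Γ δ τ))
    ∂(prodBernoulli fun _ : κ => Set.projIcc 0 1 zero_le_one t) with hP
  set Dr : ℝ → ℝ → ℝ := fun t δ => ∑ k ∈ K δ, ∫ τ,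
    flipResponse (Γ δ (τ \ {k})) (A k) (B k) (C k) (D k) (U δ) p
      ∂(prodBernoulli fun _ : κ => Set.projIcc 0 1 zero_le_one t) with hDr
  have hderiv : ∀ δ, 0 < δ → δ < 1 → ∀ t ∈ Icc (0 : ℝ) 1,
      HasDerivWithinAt (fun s => P s δ) (Dr t δ) (Icc (0 : ℝ) 1) t := by
    intro δ _ _ t ht
    exact hasDerivWithinAt_annealed_flipLeg (K δ) (Γ δ) (hΓ δ) A B C D
      (fun τ k hk => hflip δ τ k hk) (U δ) p ht
  have h := uniform_close_of_deriv_bound P Dr η 1 one_pos hderiv hkernel hη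
  intro ε hε
  obtain ⟨δ₀, hδ₀, hclose⟩ := h ε hε
  exact ⟨δ₀, hδ₀, fun δ hδ hδ' t ht t' ht' => hclose δ hδ hδ' t ht t' ht'⟩

end Summit.CriticalPhenomena.CardyFormulaZ2.Theorems

end
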